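import Mathlib

/-!
# ValiantsHypothesis / RigidityForcesSymmetry — crux `LaplaceOptimalFive` (stmt-ValiantsHypothesis-24813), line
`shallow_collision`, stub S1 `stub_onShell_five`: the COUNTING CORE of LEMMA J.

In the `x`-independent branch of the depth-one junk system the singleton flattening `{p}` carries the entry
`β p` and the pair flattening `{p,q}` carries `−β p − β q + (Σβ)/3`.  `junk_count` proves: if `β ≠ 0` then
`2·#{p : β p ≠ 0} + #{2-sets S : Σ_{p∈S} β p ≠ (Σβ)/3} ≥ 10` (so the occupied flattenings weigh
`24·# + 12·# ≥ 120`), from three disjoint families of active pairs (inside the zero set, inside the set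
`{β = (Σβ)/3}`, and across zero set × rest) and the constraint that the nonzero values sum to `Σβ`.

Honest framing.  Elementary counting; nothing here proves S1, `LaplaceOptimalFive` (OPEN) or `VP ≠ VNP`.
No definitions, no `sorry`; Mathlib only.
-/

set_option linter.dupNamespace false

namespace Summit.ValiantsHypothesis.ValiantsHypothesis.Theorems.RigidityForcesSymmetryRankRigidMinimalRepr

namespace LaplaceFiveOnShell

open Finset

/-- Numeric core of the junk count (`B ≠ 0` branch). [folklore] -/
theorem count_arith (z w r : ℕ) (h5 : z + w + r = 5) (hz : z ≤ 4) (hr : r = 0 → w = 3) :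
    10 ≤ 2 * (w + r) + z.choose 2 + w.choose 2 + z * r := by
  have hz' : z ≤ 5 := by omega
  have hw' : w ≤ 5 := by omega
  have hr' : r ≤ 5 := by omega
  interval_cases z <;> interval_cases w <;> interval_cases r <;> simp_all (config := {decide := true})

/-- Cross pairs between two disjoint sets of slots, as 2-subsets: there are `|Z|·|R|` of them. [folklore] -/
theorem card_cross_pairs (Z R : Finset (Fin 5)) (hZR : Disjoint Z R) :
    ((Z ×ˢ R).image (fun pq : Fin 5 × Fin 5 => ({pq.1, pq.2} : Finset (Fin 5)))).card = Z.card * R.card := by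
  rw [Finset.card_image_of_injOn, Finset.card_product]
  rintro ⟨p, q⟩ hpq ⟨p', q'⟩ hpq' h
  simp only [Finset.coe_product, Set.mem_prod, Finset.mem_coe] at hpq hpq'
  have h' : ({p, q} : Finset (Fin 5)) = {p', q'} := h
  have hp : p ∈ ({p', q'} : Finset (Fin 5)) := h' ▸ Finset.mem_insert_self p {q}
  have hq : q ∈ ({p', q'} : Finset (Fin 5)) := h' ▸ Finset.mem_insert_of_mem (Finset.mem_singleton_self q)
  simp only [Finset.mem_insert, Finset.mem_singleton] at hp hq
  have hpq1 : p ≠ q' := fun e => Finset.disjoint_left.mp hZR hpq.1 (e ▸ hpq'.2)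
  have hqp1 : q ≠ p' := fun e => Finset.disjoint_left.mp hZR hpq'.1 (e ▸ hpq.2)
  rcases hp with hp | hp
  · rcases hq with hq | hq
    · exact absurd hq hqp1
    · rw [hp, hq]
  · exact absurd hp hpq1

/-- **Junk count (LEMMA J, `x`-independent branch).**  For `β : Fin 5 → ℂ` not identically zero, with `B = ∑ β`:
`2·#{p : β p ≠ 0} + #{2-sets S : ∑_{p∈S} β p ≠ B/3} ≥ 10`. [folklore] -/
theorem junk_count (β : Fin 5 → ℂ) (hβ : ∃ p, β p ≠ 0) :
    10 ≤ 2 * ((Finset.univ : Finset (Fin 5)).filter (fun p => β p ≠ 0)).card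
      + (((Finset.univ : Finset (Fin 5)).powersetCard 2).filter
          (fun S₀ => S₀.sum β ≠ (∑ p, β p) / 3)).card := by
  classical
  set B : ℂ := ∑ p, β p with hB
  set N := (Finset.univ : Finset (Fin 5)).filter (fun p => β p ≠ 0) with hN
  set Z := (Finset.univ : Finset (Fin 5)).filter (fun p => β p = 0) with hZ
  set Act := ((Finset.univ : Finset (Fin 5)).powersetCard 2).filter (fun S₀ => S₀.sum β ≠ B / 3) with hAct
  have hZN : Disjoint Z N := by
    rw [hZ, hN]; exact Finset.disjoint_filter.mpr fun p _ h1 h2 => h2 h1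
  have hZNcard : Z.card + N.card = 5 := by
    have := Finset.card_filter_add_card_filter_not (s := (Finset.univ : Finset (Fin 5))) (fun p => β p = 0)
    simpa [hZ, hN] using this
  have hNpos : 0 < N.card := by
    obtain ⟨p, hp⟩ := hβ
    exact Finset.card_pos.mpr ⟨p, by rw [hN]; exact Finset.mem_filter.mpr ⟨Finset.mem_univ _, hp⟩⟩
  -- sum over the nonzero set
  have hBN : B = ∑ p ∈ N, β p := by
    rw [hB, hN, Finset.sum_filter_ne_zero]
  -- a 2-subset of `univ` built from two distinct slots
  have pair_mem : ∀ p q : Fin 5, p ≠ q → ({p, q} : Finset (Fin 5)) ∈ (Finset.univ : Finset (Fin 5)).powersetCard 2 := by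
    intro p q hpq
    rw [Finset.mem_powersetCard]
    exact ⟨Finset.subset_univ _, Finset.card_pair hpq⟩
  by_cases hB0 : B = 0
  · -- cross pairs Z × N are active
    have hsub : (Z ×ˢ N).image (fun pq : Fin 5 × Fin 5 => ({pq.1, pq.2} : Finset (Fin 5))) ⊆ Act := by
      intro S₀ hS₀
      obtain ⟨⟨p, q⟩, hpq, rfl⟩ := Finset.mem_image.mp hS₀
      rw [Finset.mem_product] at hpq
      have hp : β p = 0 := by simpa [hZ] using hpq.1
      have hq : β q ≠ 0 := by simpa [hN] using hpq.2
      have hne : p ≠ q := fun e => hq (e ▸ hp)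
      rw [hAct, Finset.mem_filter]
      refine ⟨pair_mem p q hne, ?_⟩
      rw [Finset.sum_pair hne, hp, hB0, zero_add, zero_div]
      exact hq
    have h1 : Z.card * N.card ≤ Act.card := by
      rw [← card_cross_pairs Z N hZN]; exact Finset.card_le_card hsub
    -- `N` has at least two elements: a single nonzero value cannot sum to `0`
    have hN2 : 2 ≤ N.card := by
      by_contra hlt
      have h1' : N.card = 1 := by omega
      obtain ⟨p, hp⟩ := Finset.card_eq_one.mp h1'
      have : B = β p := by rw [hBN, hp, Finset.sum_singleton]
      have hp' : p ∈ N := by rw [hp]; exact Finset.mem_singleton_self p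
      exact (by simpa [hN] using hp' : β p ≠ 0) (this ▸ hB0)
    have : 10 ≤ 2 * N.card + Z.card * N.card := by
      have hZc : Z.card = 5 - N.card := by omega
      rw [hZc]
      have : N.card ≤ 5 := by omega
      interval_cases N.card <;> omega
    omega
  · -- B ≠ 0: W = {β = B/3} ⊆ N, R = rest of N
    set W := N.filter (fun p => β p = B / 3) with hW
    set R := N.filter (fun p => β p ≠ B / 3) with hR
    have hB3 : B / 3 ≠ 0 := div_ne_zero hB0 (by norm_num)
    have hWR : W.card + R.card = N.card := by
      rw [hW, hR]; exact Finset.card_filter_add_card_filter_not _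
    have hWsub : W ⊆ N := by rw [hW]; exact Finset.filter_subset _ _
    have hRsub : R ⊆ N := by rw [hR]; exact Finset.filter_subset _ _
    have hZR : Disjoint Z R := hZN.mono_right hRsub
    -- three disjoint families of active pairs
    have fam1 : Z.powersetCard 2 ⊆ Act := by
      intro S₀ hS₀
      rw [Finset.mem_powersetCard] at hS₀
      rw [hAct, Finset.mem_filter, Finset.mem_powersetCard]
      refine ⟨⟨Finset.subset_univ _, hS₀.2⟩, ?_⟩
      have : S₀.sum β = 0 := Finset.sum_eq_zero fun p hp => by simpa [hZ] using hS₀.1 hp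
      rw [this]; exact hB3.symm
    have fam2 : W.powersetCard 2 ⊆ Act := by
      intro S₀ hS₀
      rw [Finset.mem_powersetCard] at hS₀
      rw [hAct, Finset.mem_filter, Finset.mem_powersetCard]
      refine ⟨⟨Finset.subset_univ _, hS₀.2⟩, ?_⟩
      have : S₀.sum β = ∑ _p ∈ S₀, B / 3 := Finset.sum_congr rfl fun p hp => by simpa [hW] using (Finset.mem_filter.mp (hS₀.1 hp)).2
      rw [this, Finset.sum_const, hS₀.2, nsmul_eq_mul, Nat.cast_ofNat]
      intro h
      exact hB3 (by linear_combination h)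
    have fam3 : (Z ×ˢ R).image (fun pq : Fin 5 × Fin 5 => ({pq.1, pq.2} : Finset (Fin 5))) ⊆ Act := by
      intro S₀ hS₀
      obtain ⟨⟨p, q⟩, hpq, rfl⟩ := Finset.mem_image.mp hS₀
      rw [Finset.mem_product] at hpq
      have hp : β p = 0 := by simpa [hZ] using hpq.1
      have hq : β q ≠ B / 3 := (Finset.mem_filter.mp hpq.2).2
      have hq0 : β q ≠ 0 := by
        have := hRsub hpq.2
        simpa [hN] using this
      have hne : p ≠ q := fun e => hq0 (e ▸ hp)
      rw [hAct, Finset.mem_filter]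
      refine ⟨pair_mem p q hne, ?_⟩
      rw [Finset.sum_pair hne, hp, zero_add]
      exact hq
    have d12 : Disjoint (Z.powersetCard 2) (W.powersetCard 2) := by
      rw [Finset.disjoint_left]
      intro S₀ h1 h2
      rw [Finset.mem_powersetCard] at h1 h2
      obtain ⟨p, hp⟩ := Finset.card_pos.mp (by rw [h1.2]; norm_num : 0 < S₀.card)
      have := Finset.disjoint_left.mp hZN (h1.1 hp) (hWsub (h2.1 hp))
      exact this
    have d13 : Disjoint (Z.powersetCard 2)
        ((Z ×ˢ R).image (fun pq : Fin 5 × Fin 5 => ({pq.1, pq.2} : Finset (Fin 5)))) := by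
      rw [Finset.disjoint_left]
      intro S₀ h1 h2
      rw [Finset.mem_powersetCard] at h1
      obtain ⟨⟨p, q⟩, hpq, rfl⟩ := Finset.mem_image.mp h2
      rw [Finset.mem_product] at hpq
      have hq : q ∈ Z := h1.1 (by simp)
      exact Finset.disjoint_left.mp hZR hq hpq.2
    have d23 : Disjoint (W.powersetCard 2)
        ((Z ×ˢ R).image (fun pq : Fin 5 × Fin 5 => ({pq.1, pq.2} : Finset (Fin 5)))) := by
      rw [Finset.disjoint_left]
      intro S₀ h1 h2
      rw [Finset.mem_powersetCard] at h1
      obtain ⟨⟨p, q⟩, hpq, rfl⟩ := Finset.mem_image.mp h2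
      rw [Finset.mem_product] at hpq
      have hp : p ∈ W := h1.1 (by simp)
      exact Finset.disjoint_left.mp hZN hpq.1 (hWsub hp)
    have hcard : Z.card.choose 2 + W.card.choose 2 + Z.card * R.card ≤ Act.card := by
      have hu : (Z.powersetCard 2 ∪ W.powersetCard 2
          ∪ (Z ×ˢ R).image (fun pq : Fin 5 × Fin 5 => ({pq.1, pq.2} : Finset (Fin 5)))) ⊆ Act :=
        Finset.union_subset (Finset.union_subset fam1 fam2) fam3
      have := Finset.card_le_card hu
      rw [Finset.card_union_of_disjoint (Finset.disjoint_union_left.mpr ⟨d13, d23⟩),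
        Finset.card_union_of_disjoint d12, Finset.card_powersetCard, Finset.card_powersetCard,
        card_cross_pairs Z R hZR] at this
      exact this
    -- the constraint: if `R = ∅` then `|W| = 3`
    have hcons : R.card = 0 → W.card = 3 := by
      intro hR0
      have hR0' : R = ∅ := Finset.card_eq_zero.mp hR0
      have hWN : W = N := by
        apply Finset.Subset.antisymm hWsub
        intro p hp
        by_contra hpW
        have : p ∈ R := by
          rw [hR]; refine Finset.mem_filter.mpr ⟨hp, fun h => hpW ?_⟩
          rw [hW]; exact Finset.mem_filter.mpr ⟨hp, h⟩
        rw [hR0'] at this; exact absurd this (Finset.notMem_empty p)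
      have hsum : B = ∑ _p ∈ N, B / 3 := by
        conv_lhs => rw [hBN]
        refine Finset.sum_congr rfl fun p hp => ?_
        have : p ∈ W := hWN ▸ hp
        exact (Finset.mem_filter.mp this).2
      rw [Finset.sum_const, nsmul_eq_mul] at hsum
      have h3 : (N.card : ℂ) = 3 := by
        have : (N.card : ℂ) * (B / 3) - B = 0 := by rw [← hsum, sub_self]
        have hB' : B ≠ 0 := hB0
        have : ((N.card : ℂ) - 3) * B = 0 := by linear_combination (3 : ℂ) * this
        rcases mul_eq_zero.mp this with h | h
        · linear_combination h
        · exact absurd h hB'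
      have : N.card = 3 := by exact_mod_cast h3
      rw [hWN, this]
    have := count_arith Z.card W.card R.card (by omega) (by omega) hcons
    omega

end LaplaceFiveOnShell

end Summit.ValiantsHypothesis.ValiantsHypothesis.Theorems.RigidityForcesSymmetryRankRigidMinimalRepr
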